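import Literature.AlgebraicGeometry.Resolution.BlowupAlgebraAbsorption
import Mathlib.RingTheory.DedekindDomain.Dvr
import Mathlib.RingTheory.DiscreteValuationRing.Basic
import Mathlib.RingTheory.RegularLocalRing.Defs
import Mathlib.Algebra.CharP.Algebra
import HarnessLib

/-!
# Chart local rings of blow-ups of Dedekind domains, and of `B`-ideals below them (absorption)
# (crux `FInjectiveMacaulayfication` stmt-ResolutionOfSingularities-15315, chain w45a, plan-1 R13.14 (3), part 1/2)

[OURS · L1 W4.5a · res-D-pv-019 AS res-L1-w45a-stub-7] Support file (`--supports stmt-ResolutionOfSingularities-15315 --as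
helper`) for the crux `FrobeniusLadder.FInjectiveMacaulayfication`; NOT a statement of any manuscript; AI-written, weaker than
expert review. Generic ring-level lemmas consumed by `…PointFixDimOne.lean` («5e in dimension one»):

* `localRingHom_bijective_of_valuationRing` — CHART LOCAL RINGS OF A BIRATIONAL EXTENSION OVER A VALUATION RING: if `B ⊆ S ⊆ B[1/t]`
  are domains and `𝔔'` is a prime of `S` whose contraction `𝔮` has `B_𝔮` a valuation ring, then `B_𝔮 → S_𝔔'` is an
  ISOMORPHISM — injective as `B → S_𝔔'` is; surjective because for `r = β₁/β₂ ∈ S_𝔔'` (`βᵢ ∈ B`) either `β₂ ∣ β₁` in `B_𝔮`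
  (and `r` is the quotient) or `β₁ ∣ β₂`, `β₂ = β₁ c`, and then `r·c = 1` in `S_𝔔'` makes `c` a unit of `B_𝔮` (local
  homomorphism), `r = c⁻¹` (valuation rings are maximal for domination);
* `isRegularLocalRing_atPrime_blowupAlgebra_of_isDedekindDomain` — for a Dedekind domain `B`, every local ring of a chart
  `B[J/t]` (`t ≠ 0`) at a prime over a NONZERO prime `𝔮` of `B` is regular (it is the DVR `B_𝔮`);
* `isRegularLocalRing_atPrime_chart_of_absorb` — for `φ : A ↪ B`, `B` Dedekind, `I ⊆ A` a `B`-ideal and `0 ≠ a ∈ I`, every local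
  ring of `A[I/a]` at a prime with nonzero contraction to `A` is regular: ABSORPTION `A[I/a] ≅ B[IB/a]`
  (`Literature/…/BlowupAlgebraAbsorption.lean`, p531939) + the previous item;
* `charP_atPrime_blowupAlgebra` — the chart local rings of a domain of characteristic `p` have characteristic `p`.
No sorry, no definitions, no named facts.
-/

-- single-problem summit: the doubled namespace component is forced
set_option linter.dupNamespace false

noncomputable section

open IsLocalRing Literature.AlgebraicGeometry.Resolution

namespace Summit.ResolutionOfSingularities.ResolutionOfSingularities.Theorems.FInjectiveMacaulayfication.DedekindBlowupCharts

/-! ## 1. Chart local rings of a birational extension over a valuation ring -/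

section Birational

variable {B S : Type} [CommRing B] [IsDomain B] [CommRing S] [IsDomain S] [Algebra B S]

/-- **Local rings of a birational extension over a valuation ring.** Let `B ⊆ S` be domains with `S` birational over `B` through
powers of `t ≠ 0` (`∀ x ∈ S, x·tⁿ ∈ B` for some `n`), `𝔔'` a prime of `S` and `𝔮 = 𝔔' ∩ B`. If `B_𝔮` is a valuation ring, the
canonical local homomorphism `B_𝔮 → S_𝔔'` is BIJECTIVE (valuation rings are maximal for domination). [folklore] -/
theorem localRingHom_bijective_of_valuationRing (hinj : Function.Injective (algebraMap B S)) {t : B} (ht : t ≠ 0)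
    (hbir : ∀ x : S, ∃ (n : ℕ) (β : B), x * algebraMap B S t ^ n = algebraMap B S β)
    (𝔔' : Ideal S) [𝔔'.IsPrime] [ValuationRing (Localization.AtPrime (𝔔'.comap (algebraMap B S)))] :
    Function.Bijective
      (Localization.localRingHom (𝔔'.comap (algebraMap B S)) 𝔔' (algebraMap B S) rfl) := by
  have hιS : Function.Injective (algebraMap S (Localization.AtPrime 𝔔')) :=
    IsLocalization.injective (Localization.AtPrime 𝔔') 𝔔'.primeCompl_le_nonZeroDivisors
  have hιB : Function.Injective (algebraMap B (Localization.AtPrime (𝔔'.comap (algebraMap B S)))) :=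
    IsLocalization.injective (Localization.AtPrime (𝔔'.comap (algebraMap B S)))
      (𝔔'.comap (algebraMap B S)).primeCompl_le_nonZeroDivisors
  have hft : algebraMap B S t ≠ 0 := fun h => ht (hinj (by rw [h, map_zero]))
  have hg_alg : ∀ b : B, Localization.localRingHom (𝔔'.comap (algebraMap B S)) 𝔔' (algebraMap B S) rfl
      (algebraMap B _ b) = algebraMap S (Localization.AtPrime 𝔔') (algebraMap B S b) := fun b =>
    Localization.localRingHom_to_map _ _ _ rfl b
  refine ⟨?_, ?_⟩
  · -- injective: `B → S → S_𝔔'` is injective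
    rw [injective_iff_map_eq_zero]
    intro v hv
    obtain ⟨⟨b, s⟩, rfl⟩ := IsLocalization.mk'_surjective (𝔔'.comap (algebraMap B S)).primeCompl v
    simp only [Localization.localRingHom_mk', IsLocalization.mk'_eq_zero_iff] at hv
    obtain ⟨m, hm⟩ := hv
    have hm0 : (m : S) ≠ 0 := fun h => m.2 (by rw [h]; exact 𝔔'.zero_mem)
    have hb : algebraMap B S b = 0 := by
      rcases mul_eq_zero.mp hm with h | h
      · exact absurd h hm0
      · exact h
    have hb0 : b = 0 := hinj (by rw [hb, map_zero])
    show IsLocalization.mk' _ b s = 0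
    rw [hb0, IsLocalization.mk'_zero]
  · -- surjective
    intro r
    obtain ⟨⟨x, s⟩, rfl⟩ := IsLocalization.mk'_surjective 𝔔'.primeCompl r
    obtain ⟨n, β, hβ⟩ := hbir x
    obtain ⟨m, σ, hσ⟩ := hbir s.1
    have hs0 : (s : S) ≠ 0 := fun h => s.2 (by rw [h]; exact 𝔔'.zero_mem)
    have hσ0 : σ ≠ 0 := by
      rintro rfl
      rw [map_zero] at hσ
      exact (mul_ne_zero hs0 (pow_ne_zero _ hft)) hσ
    -- `b₂ := σ tⁿ ≠ 0`, `b₁ := β tᵐ`, and `r · ι(b₂) = ι(b₁)` in `S_𝔔'`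
    have hb₂0 : σ * t ^ n ≠ 0 := mul_ne_zero hσ0 (pow_ne_zero _ ht)
    have hkey : IsLocalization.mk' (Localization.AtPrime 𝔔') x s *
        algebraMap S (Localization.AtPrime 𝔔') (algebraMap B S (σ * t ^ n)) =
        algebraMap S (Localization.AtPrime 𝔔') (algebraMap B S (β * t ^ m)) := by
      have hxs : IsLocalization.mk' (Localization.AtPrime 𝔔') x s * algebraMap S (Localization.AtPrime 𝔔') s.1 =
          algebraMap S (Localization.AtPrime 𝔔') x := IsLocalization.mk'_spec _ x s
      calc IsLocalization.mk' (Localization.AtPrime 𝔔') x s *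
            algebraMap S (Localization.AtPrime 𝔔') (algebraMap B S (σ * t ^ n))
          = IsLocalization.mk' (Localization.AtPrime 𝔔') x s * algebraMap S (Localization.AtPrime 𝔔') s.1 *
              algebraMap S (Localization.AtPrime 𝔔') (algebraMap B S t) ^ m *
              algebraMap S (Localization.AtPrime 𝔔') (algebraMap B S t) ^ n := by
            rw [map_mul, map_pow, ← hσ, map_mul, map_pow, map_mul, map_pow]; ring
        _ = algebraMap S (Localization.AtPrime 𝔔') x * algebraMap S (Localization.AtPrime 𝔔') (algebraMap B S t) ^ n *
              algebraMap S (Localization.AtPrime 𝔔') (algebraMap B S t) ^ m := by rw [hxs]; ring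
        _ = algebraMap S (Localization.AtPrime 𝔔') (algebraMap B S (β * t ^ m)) := by
            rw [← map_pow, ← map_mul, hβ, map_mul, map_pow, map_mul, map_pow]
    have hι₂ : algebraMap S (Localization.AtPrime 𝔔') (algebraMap B S (σ * t ^ n)) ≠ 0 := fun h =>
      hb₂0 (hinj (hιS (by rw [h, map_zero, map_zero])))
    -- the valuation ring dichotomy in `B_𝔮`
    obtain ⟨c, hc⟩ := ValuationRing.cond (algebraMap B (Localization.AtPrime (𝔔'.comap (algebraMap B S))) (σ * t ^ n))
      (algebraMap B (Localization.AtPrime (𝔔'.comap (algebraMap B S))) (β * t ^ m))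
    rcases hc with hc | hc
    · -- `b₂ c = b₁`: `r = g c`
      refine ⟨c, ?_⟩
      have h1 := congrArg (Localization.localRingHom (𝔔'.comap (algebraMap B S)) 𝔔' (algebraMap B S) rfl) hc
      rw [map_mul, hg_alg, hg_alg, ← hkey, mul_comm] at h1
      exact mul_right_cancel₀ hι₂ h1
    · -- `b₁ c = b₂`: `r · g c = 1`, so `c` is a unit and `r = g c⁻¹`
      have hb₁0 : β * t ^ m ≠ 0 := by
        intro h0
        rw [h0, map_zero, zero_mul] at hc
        exact hb₂0 (hιB (by rw [← hc, map_zero]))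
      have hι₁ : algebraMap S (Localization.AtPrime 𝔔') (algebraMap B S (β * t ^ m)) ≠ 0 := fun h =>
        hb₁0 (hinj (hιS (by rw [h, map_zero, map_zero])))
      have h1 := congrArg (Localization.localRingHom (𝔔'.comap (algebraMap B S)) 𝔔' (algebraMap B S) rfl) hc
      rw [map_mul, hg_alg, hg_alg] at h1
      -- `ι(b₁) * (r * g c) = ι(b₁) * 1`
      have h2 : algebraMap S (Localization.AtPrime 𝔔') (algebraMap B S (β * t ^ m)) *
          (IsLocalization.mk' (Localization.AtPrime 𝔔') x s *
            Localization.localRingHom (𝔔'.comap (algebraMap B S)) 𝔔' (algebraMap B S) rfl c) =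
          algebraMap S (Localization.AtPrime 𝔔') (algebraMap B S (β * t ^ m)) * 1 := by
        calc _ = IsLocalization.mk' (Localization.AtPrime 𝔔') x s *
              (algebraMap S (Localization.AtPrime 𝔔') (algebraMap B S (β * t ^ m)) *
                Localization.localRingHom (𝔔'.comap (algebraMap B S)) 𝔔' (algebraMap B S) rfl c) := by ring
          _ = _ := by rw [h1, hkey, mul_one]
      have h3 := mul_left_cancel₀ hι₁ h2
      obtain ⟨u, hu⟩ := (isUnit_map_iff (Localization.localRingHom (𝔔'.comap (algebraMap B S)) 𝔔' (algebraMap B S) rfl)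
        c).mp (IsUnit.of_mul_eq_one_right _ h3)
      refine ⟨↑u⁻¹, ?_⟩
      rw [← hu] at h3
      calc Localization.localRingHom (𝔔'.comap (algebraMap B S)) 𝔔' (algebraMap B S) rfl ↑u⁻¹
          = IsLocalization.mk' (Localization.AtPrime 𝔔') x s *
              Localization.localRingHom (𝔔'.comap (algebraMap B S)) 𝔔' (algebraMap B S) rfl ↑u *
              Localization.localRingHom (𝔔'.comap (algebraMap B S)) 𝔔' (algebraMap B S) rfl ↑u⁻¹ := by
            rw [h3, one_mul]
        _ = IsLocalization.mk' (Localization.AtPrime 𝔔') x s := by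
            rw [mul_assoc, ← map_mul, Units.mul_inv, map_one, mul_one]

/-- Under the hypotheses of `localRingHom_bijective_of_valuationRing`, if moreover `B_𝔮` is a regular local ring (e.g. a DVR)
then so is `S_𝔔'`. [folklore] -/
theorem isRegularLocalRing_of_valuationRing (hinj : Function.Injective (algebraMap B S)) {t : B} (ht : t ≠ 0)
    (hbir : ∀ x : S, ∃ (n : ℕ) (β : B), x * algebraMap B S t ^ n = algebraMap B S β)
    (𝔔' : Ideal S) [𝔔'.IsPrime] [ValuationRing (Localization.AtPrime (𝔔'.comap (algebraMap B S)))]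
    [IsRegularLocalRing (Localization.AtPrime (𝔔'.comap (algebraMap B S)))] :
    IsRegularLocalRing (Localization.AtPrime 𝔔') :=
  IsRegularLocalRing.of_ringEquiv (R := Localization.AtPrime (𝔔'.comap (algebraMap B S)))
    (RingEquiv.ofBijective _ (localRingHom_bijective_of_valuationRing hinj ht hbir 𝔔'))

end Birational

/-! ## 2. Chart local rings of the blowing up of a Dedekind domain along an ideal are DVRs -/

/-- For a domain `B`, `t ≠ 0` and an ideal `J`, the affine blowup algebra `B[J/t] ⊆ B[1/t]` is birational over `B` through
powers of `t`, and `B → B[J/t]` is injective. [folklore] -/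
theorem blowupAlgebra_birational {B : Type} [CommRing B] [IsDomain B] (J : Ideal B) {t : B} (ht : t ≠ 0) :
    Function.Injective (algebraMap B (blowupAlgebra J t)) ∧
      ∀ x : blowupAlgebra J t, ∃ (n : ℕ) (β : B),
        x * algebraMap B (blowupAlgebra J t) t ^ n = algebraMap B (blowupAlgebra J t) β := by
  have hL : Function.Injective (algebraMap B (Localization.Away t)) :=
    IsLocalization.injective (Localization.Away t) (powers_le_nonZeroDivisors_of_noZeroDivisors ht)
  refine ⟨fun x y h => hL (congrArg Subtype.val h), fun x => ?_⟩
  obtain ⟨⟨β, ⟨_, n, rfl⟩⟩, hβ⟩ := IsLocalization.surj (Submonoid.powers t) (x : Localization.Away t)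
  refine ⟨n, β, Subtype.ext ?_⟩
  simp only [Subalgebra.coe_mul, Subalgebra.coe_algebraMap, ← map_pow]
  exact hβ

/-- **Chart local rings of `Bl_J Spec B`, `B` Dedekind.** For a Dedekind domain `B`, an ideal `J`, `t ≠ 0`, and a prime `𝔔'` of
the chart `B[J/t]` whose contraction `𝔮 = 𝔔' ∩ B` is nonzero, the local ring `B[J/t]_𝔔'` is a regular local ring (it is the DVR
`B_𝔮`, `localRingHom_bijective_of_valuationRing`). [folklore] -/
theorem isRegularLocalRing_atPrime_blowupAlgebra_of_isDedekindDomain {B : Type} [CommRing B] [IsDedekindDomain B]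
    (J : Ideal B) {t : B} (ht : t ≠ 0) (𝔔' : Ideal (blowupAlgebra J t)) [𝔔'.IsPrime]
    (h𝔮 : 𝔔'.comap (algebraMap B (blowupAlgebra J t)) ≠ ⊥) :
    IsRegularLocalRing (Localization.AtPrime 𝔔') := by
  haveI : IsDomain (Localization.Away t) :=
    IsLocalization.isDomain_localization (powers_le_nonZeroDivisors_of_noZeroDivisors ht)
  haveI : IsDomain (blowupAlgebra J t) := Subalgebra.isDomain _
  haveI : IsDiscreteValuationRing (Localization.AtPrime (𝔔'.comap (algebraMap B (blowupAlgebra J t)))) :=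
    IsLocalization.AtPrime.isDiscreteValuationRing_of_dedekind_domain B h𝔮 _
  obtain ⟨hinj, hbir⟩ := blowupAlgebra_birational J ht
  exact isRegularLocalRing_of_valuationRing hinj ht hbir 𝔔'

/-! ## 3. Absorption: the charts of `Bl_I Spec A` for a `B`-ideal `I`, `B` Dedekind over `A` -/

/-- Transport of the local rings along a ring isomorphism: `R_{e⁻¹ 𝔔'} ≅ R'_𝔔'`. [folklore] -/
theorem nonempty_atPrime_ringEquiv_of_ringEquiv {R R' : Type} [CommRing R] [CommRing R'] (e : R ≃+* R')
    (𝔔 : Ideal R) (𝔔' : Ideal R') [𝔔.IsPrime] [𝔔'.IsPrime] (h : 𝔔 = 𝔔'.comap e.toRingHom) :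
    Nonempty (Localization.AtPrime 𝔔' ≃+* Localization.AtPrime 𝔔) := by
  have hmap : 𝔔'.primeCompl.map e.symm.toMonoidHom = 𝔔.primeCompl := by
    ext y
    simp only [Submonoid.mem_map, Ideal.mem_primeCompl_iff, h, Ideal.mem_comap, RingEquiv.toRingHom_eq_coe,
      RingHom.coe_coe]
    constructor
    · rintro ⟨x, hx, rfl⟩
      simpa using hx
    · intro hy
      exact ⟨e y, hy, by simp⟩
  exact ⟨IsLocalization.ringEquivOfRingEquiv (Localization.AtPrime 𝔔') (Localization.AtPrime 𝔔) e.symm hmap⟩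

/-- **Charts of `Bl_I Spec A` at primes over a nonzero prime, `I` a `B`-ideal, `B` Dedekind.** Let `φ : A → B` be injective with
`B` a Dedekind domain, `I` an ideal of `A` which is a `B`-ideal (`b·φ(x) ∈ φ(I)` for `b ∈ B`, `x ∈ I`), `a ∈ I` nonzero, and
`𝔔` a prime of the chart `A[I/a]` whose contraction to `A` is nonzero. Then `A[I/a]_𝔔` is a regular local ring (a DVR): by
absorption `A[I/a] ≅ B[IB/a]` (`BlowupAlgebraAbsorption.exists_ringEquiv_of_absorb`) and
`isRegularLocalRing_atPrime_blowupAlgebra_of_isDedekindDomain`. [folklore] -/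
theorem isRegularLocalRing_atPrime_chart_of_absorb {A B : Type} [CommRing A] [CommRing B] [IsDedekindDomain B]
    (φ : A →+* B) (hφ : Function.Injective φ) (I : Ideal A) {a : A} (ha : a ∈ I) (ha0 : a ≠ 0)
    (hIB : ∀ (b : B) (x : A), x ∈ I → ∃ y ∈ I, φ y = b * φ x)
    (𝔔 : Ideal (blowupAlgebra I a)) [𝔔.IsPrime] (h𝔔 : 𝔔.comap (algebraMap A (blowupAlgebra I a)) ≠ ⊥) :
    IsRegularLocalRing (Localization.AtPrime 𝔔) := by
  have hφa : φ a ≠ 0 := fun h => ha0 (hφ (by rw [h, map_zero]))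
  obtain ⟨e, _, healg⟩ := BlowupAlgebraAbsorption.exists_ringEquiv_of_absorb φ I a hφ ha hIB
  -- the corresponding prime `𝔔'` of `B[IB/a]`; its contraction to `B` is nonzero since it lies over `𝔔 ∩ A ≠ 0`
  haveI h𝔔'p : (𝔔.comap e.symm.toRingHom).IsPrime := Ideal.comap_isPrime _ _
  have h𝔔𝔔' : 𝔔 = (𝔔.comap e.symm.toRingHom).comap e.toRingHom := by
    ext x
    simp only [Ideal.mem_comap, RingEquiv.toRingHom_eq_coe, RingHom.coe_coe, RingEquiv.symm_apply_apply]
  have h𝔮 : (𝔔.comap e.symm.toRingHom).comap (algebraMap B (blowupAlgebra (I.map φ) (φ a))) ≠ ⊥ := by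
    intro h0
    apply h𝔔
    have hcomp : e.toRingHom.comp (algebraMap A (blowupAlgebra I a)) =
        (algebraMap B (blowupAlgebra (I.map φ) (φ a))).comp φ :=
      RingHom.ext fun x => by
        simp only [RingHom.coe_comp, Function.comp_apply, RingEquiv.toRingHom_eq_coe, RingHom.coe_coe]
        exact healg x
    rw [h𝔔𝔔', Ideal.comap_comap, hcomp, ← Ideal.comap_comap, h0, Ideal.comap_bot_of_injective φ hφ]
  haveI : IsRegularLocalRing (Localization.AtPrime (𝔔.comap e.symm.toRingHom)) :=
    isRegularLocalRing_atPrime_blowupAlgebra_of_isDedekindDomain _ hφa _ h𝔮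
  obtain ⟨eloc⟩ := nonempty_atPrime_ringEquiv_of_ringEquiv e 𝔔 (𝔔.comap e.symm.toRingHom) h𝔔𝔔'
  exact IsRegularLocalRing.of_ringEquiv (R := Localization.AtPrime (𝔔.comap e.symm.toRingHom)) eloc

/-- The local rings of the charts `A[I/a]`, `a ≠ 0`, `A` a domain of characteristic `p`, have characteristic `p`. [folklore] -/
theorem charP_atPrime_blowupAlgebra {A : Type} [CommRing A] [IsDomain A] (p : ℕ) [CharP A p] (I : Ideal A) {a : A}
    (ha0 : a ≠ 0) (𝔔 : Ideal (blowupAlgebra I a)) [𝔔.IsPrime] : CharP (Localization.AtPrime 𝔔) p := by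
  haveI : IsDomain (Localization.Away a) :=
    IsLocalization.isDomain_localization (powers_le_nonZeroDivisors_of_noZeroDivisors ha0)
  haveI : IsDomain (blowupAlgebra I a) := Subalgebra.isDomain _
  exact charP_of_injective_ringHom (f := (algebraMap (blowupAlgebra I a) (Localization.AtPrime 𝔔)).comp
    (algebraMap A (blowupAlgebra I a)))
    ((IsLocalization.injective (Localization.AtPrime 𝔔) 𝔔.primeCompl_le_nonZeroDivisors).comp
      (blowupAlgebra_birational I ha0).1) p

end Summit.ResolutionOfSingularities.ResolutionOfSingularities.Theorems.FInjectiveMacaulayfication.DedekindBlowupCharts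

end
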